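import Literature.Computability.AlgebraicComplexity.PowerSumProductMultiplicityObstruction
import Literature.Computability.AlgebraicComplexity.PowerSumProductObstructionsProofs
import Literature.Barriers.ValiantsHypothesis.NotViaSaturationsAlonTarsiDrisko
import Literature.Computability.AlgebraicComplexity.MultiplicityObstructionsProofs
import HarnessLib

/-!
# Ikenmeyer–Kandasamy's pure multiplicity obstructions, hypothesis-free

Topic `Literature/Computability/AlgebraicComplexity` (the toy pair power sum `p = x₁^m + ⋯ + x_m^m`
versus product of variables `q = x₁ ⋯ x_m`, `PowerSumProductObstructions.lean`). With the three
named facts of that file now tree theorems — `IK2020_thm_4_3_holds`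
(`PowerSumProductMultiplicityObstruction.lean`), `IK2020_prop_5_3_1_holds`
(`PowerSumWaringRankEquation.lean`), `IK2020_prop_5_3_2_holds` / `IK2020_prop_5_3_2_primes_holds`
(`PowerSumProductObstructionsProofs.lean`; `ChowOccurrencePrimeAdjacent.lean`, whose one-line proof term
`IK2020_prop_5_3_2_primes_of_alonTarsi Drisko1997_AlonTarsi_holds Glynn2010_AlonTarsi_holds` is
used here directly, so that this file does not import that module) — and the
multiplicity-obstruction principle `orbitMultiplicity_le_of_mem_orbitClosure_holds`
(`MultiplicityObstructionsProofs.lean`), the KERNEL corollaries of `PowerSumProductObstructions.lean`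
become HYPOTHESIS-FREE theorems. This file records them (theorems only; no new definitions, no new
facts):

* C. Ikenmeyer, U. Kandasamy, STOC 2020 = arXiv:1911.03990, §2 (p. 3): "In this paper we use this
  approach to prove the first family of multiplicity obstructions that are neither occurrence
  obstructions, nor so-called vanishing ideal occurrence obstructions"; Thm. 4.3 (p. 8): "`ν` is a
  multiplicity obstruction that proves the separation `\overline{Gp} ⊄ \overline{Gq}`"; Prop. 5.3
  (p. 10): "`ν` is not a vanishing ideal occurrence obstruction … If `m` satisfies the Alon-Tarsi
  condition, then … `ν` is not an occurrence obstruction. In particular this is true for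
  `m = τ ± 1` for all odd primes `τ`."

Here `ν = (2m) + (m × 2m) = (4m, 2m, …, 2m)` (`ikPartition m`), and a PURE multiplicity
obstruction at `ν^*` means `0 < mult_{ν^*}(q) < mult_{ν^*}(p) < a_ν(2m+2, m)`
(`IsPureMultiplicityObstructionAt`: neither an occurrence obstruction nor a vanishing ideal
occurrence obstruction). Every even `4 ≤ m ≤ 24` is of the form `τ ± 1` (`4 = 3+1`, `6 = 5+1`,
`8 = 7+1`, `10 = 11-1`, …, `24 = 23+1`), so `isPureMultiplicityObstructionAt_of_prime` covers them;
the `≤ 24` statement is also given through the tree's `alonTarsi_of_even_le_24` (Drisko, Glynn;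
Glynn Cor. 3.4: "The smallest unsolved case of even order for the Alon-Tarsi conjecture … is 26").
Honest framing of the cell served (`pub-gct-max`, track T): kernel-checked instances, in IK'20's
toy setting (power sum vs product of variables, not determinant vs permanent), of multiplicity
obstructions that are not occurrence obstructions; nothing here is a claim on VP vs VNP or P vs NP.

## References

* C. Ikenmeyer, U. Kandasamy, Proc. 52nd ACM STOC (2020) 713–726 = arXiv:1911.03990, §2, Thm. 4.3,
  Prop. 5.3. [IkenmeyerKandasamy2019]
* A. A. Drisko, Adv. Math. 128 (1997) 20–35, Thm. 9. [Drisko1997]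
* D. G. Glynn, SIAM J. Discrete Math. 24 (2010) 394–399, Thm. 3.2, Cor. 3.4. [Glynn2010AlonTarsi]
-/

noncomputable section

namespace Literature.Computability.AlgebraicComplexity

open MvPolynomial
open _root_.Literature.NumberTheory.DiophantineGeometry
open _root_.Literature.Barriers.ValiantsHypothesis

namespace IK2020

/-- **The separation of IK Thm. 4.3, hypothesis-free**: for every even `m ≥ 4`,
`x₁^m + ⋯ + x_m^m ∉ \overline{GL_m · x₁⋯x_m}` ("`ν` is a multiplicity obstruction that proves the
separation `\overline{Gp} ⊄ \overline{Gq}`"). [cite: IkenmeyerKandasamy2019, Thm. 4.3] -/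
theorem psum_not_mem_orbitClosure_chowMonomial {m : ℕ} (h4 : 4 ≤ m) (he : Even m) :
    psum (Fin m) ℂ m ∉ orbitClosure (chowMonomial ℂ m) :=
  ik2020_psum_not_mem_orbitClosure IK2020_thm_4_3_holds
    orbitMultiplicity_le_of_mem_orbitClosure_holds h4 he

/-- **IK Thm. 4.3 as a multiplicity obstruction, hypothesis-free**: for every even `m ≥ 4`,
`mult_{ν^*}(q) ≤ 1 < 2 ≤ mult_{ν^*}(p)`. [cite: IkenmeyerKandasamy2019, Thm. 4.3] -/
theorem isMultiplicityObstructionAt {m : ℕ} (h4 : 4 ≤ m) (he : Even m) :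
    IsMultiplicityObstructionAt (chowMonomial ℂ m) (psum (Fin m) ℂ m) m
      (Weight.dualOfPartition m (ikPartition m)) :=
  ik2020_isMultiplicityObstructionAt IK2020_thm_4_3_holds h4 he

/-- **IK's pure multiplicity obstructions at `m = τ ± 1`, hypothesis-free** (IK §2: "the first
family of multiplicity obstructions that are neither occurrence obstructions, nor so-called
vanishing ideal occurrence obstructions"; Prop. 5.3: "In particular this is true for `m = τ ± 1`
for all odd primes `τ`"): for `m ≥ 4`, `τ` an odd prime and `m = τ + 1` or `m = τ - 1`,
`0 < mult_{ν^*}(q) ≤ 1 < 2 ≤ mult_{ν^*}(p) < a_ν(2m+2, m)`.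
[cite: IkenmeyerKandasamy2019, Prop. 5.3] -/
theorem isPureMultiplicityObstructionAt_of_prime {m τ : ℕ} (h4 : 4 ≤ m) (hτ : τ.Prime)
    (hodd : Odd τ) (hm : m = τ + 1 ∨ m = τ - 1) :
    IsPureMultiplicityObstructionAt (chowMonomial ℂ m) (psum (Fin m) ℂ m) m
      (Weight.dualOfPartition m (ikPartition m)) :=
  ik2020_isPureMultiplicityObstructionAt_of_prime IK2020_thm_4_3_holds IK2020_prop_5_3_1_holds
    (IK2020_prop_5_3_2_primes_of_alonTarsi Drisko1997_AlonTarsi_holds Glynn2010_AlonTarsi_holds)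
    h4 hτ hodd hm

/-- **The smallest instance, hypothesis-free** (`m = 4 = 3 + 1`): `ν = (16, 8, 8, 8)` is a pure
multiplicity obstruction against `x₁⁴ + x₂⁴ + x₃⁴ + x₄⁴ ∈ \overline{GL₄ · x₁x₂x₃x₄}`.
[cite: IkenmeyerKandasamy2019, Thm. 4.3] -/
theorem isPureMultiplicityObstructionAt_four :
    IsPureMultiplicityObstructionAt (chowMonomial ℂ 4) (psum (Fin 4) ℂ 4) 4
      (Weight.dualOfPartition 4 (ikPartition 4)) :=
  ik2020_isPureMultiplicityObstructionAt_four IK2020_thm_4_3_holds IK2020_prop_5_3_1_holds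
    (IK2020_prop_5_3_2_primes_of_alonTarsi Drisko1997_AlonTarsi_holds Glynn2010_AlonTarsi_holds)

/-- **IK's pure multiplicity obstructions under the Alon–Tarsi condition, otherwise
hypothesis-free** (Prop. 5.3: "If `m` satisfies the Alon-Tarsi condition, then
`mult_{ν^*} ℂ[\overline{Gq}] > 0` and hence `ν` is not an occurrence obstruction"): for every even
`m ≥ 4` satisfying the Alon–Tarsi condition, `ν` is a pure multiplicity obstruction.
[cite: IkenmeyerKandasamy2019, Prop. 5.3] -/
theorem isPureMultiplicityObstructionAt_of_alonTarsi {m : ℕ} (h4 : 4 ≤ m) (he : Even m)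
    (hAT : AlonTarsiConjecture m) :
    IsPureMultiplicityObstructionAt (chowMonomial ℂ m) (psum (Fin m) ℂ m) m
      (Weight.dualOfPartition m (ikPartition m)) :=
  ik2020_isPureMultiplicityObstructionAt IK2020_thm_4_3_holds IK2020_prop_5_3_1_holds
    IK2020_prop_5_3_2_holds h4 he hAT

/-- **Every even `4 ≤ m ≤ 24`, hypothesis-free**: `ν = (4m, 2m, …, 2m)` is a pure multiplicity
obstruction against `x₁^m + ⋯ + x_m^m ∈ \overline{GL_m · x₁⋯x_m}` (the Alon–Tarsi condition at
these `m` is the tree's `alonTarsi_of_even_le_24` from Drisko 1997 and Glynn 2010; every such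
`m` is `τ ± 1`). [cite: IkenmeyerKandasamy2019, Prop. 5.3] [cite: Glynn2010AlonTarsi, Cor. 3.4] -/
theorem isPureMultiplicityObstructionAt_of_even_le_24 {m : ℕ} (h4 : 4 ≤ m) (he : Even m)
    (h24 : m ≤ 24) :
    IsPureMultiplicityObstructionAt (chowMonomial ℂ m) (psum (Fin m) ℂ m) m
      (Weight.dualOfPartition m (ikPartition m)) :=
  ik2020_isPureMultiplicityObstructionAt_of_even_le_24 IK2020_thm_4_3_holds
    IK2020_prop_5_3_1_holds IK2020_prop_5_3_2_holds Drisko1997_AlonTarsi_holds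
    Glynn2010_AlonTarsi_holds h4 he h24

end IK2020

end Literature.Computability.AlgebraicComplexity

end
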